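import Summits.QuantumFields.YangMills.Theorems.IR.BlockedActivityUnivShellCond
import Summits.QuantumFields.YangMills.Theorems.BalabanLadderIRAfOnsetPlaquetteMoments
import Literature.MathematicalPhysics.QuantumLattice.LatticeGaugeDLRBoxKernels
import Literature.MathematicalPhysics.QuantumLattice.LatticeGaugeDLRProofs
import Literature.MathematicalPhysics.QuantumLattice.RepLieAlgebraUnitary
import Literature.MathematicalPhysics.QuantumLattice.GaugeGroupsProofs
import Literature.MathematicalPhysics.QuantumFieldTheory.YangMillsOS
import Literature.Barriers.QuantumFields.CenterSymmetryBreakingByQuarks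
import Literature.Barriers.QuantumFields.FiniteTemperatureDeconfinement
import HarnessLib

/-!
# Crux `IR` (stmt-QuantumFields-19354), lane B: the CENTRAL POINT-GAUGE FLIP against a σ-uniform blocked representation
# (O-112 toolkit; Negative∕ lane, `--supports` only; consumed by `Negative/BlockedActivityOnsetFalse`)

PROVENANCE.  Mechanism, frame ∕ corner-plaquette algebra and the `ρ(z) = −𝟙` case: crux-triage seat 1 (`ym-ctriage-19354-1` g16, desk bytes
`checks-rev16/BlockedActivityOnsetFalse.lean`, sha16 `4c97a1a34b5854c1`, O-112).  Filed and generalised to an ARBITRARY central scalar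
`ρ(z) = c·𝟙` (fixed-phase trick) by the Negative∕ single writer of this crux (refuter `ym-19354-disprove-1` g9, owner R103 (c)).

CONTENT.  `Theorems/IR/BlockedActivityDefs` (p527934): `BlockedRep ρ β w Y a` represents the kernel expectation of EVERY centre observable under
EVERY exterior datum `σ` through ONE σ-independent reference `(Ω, μ, obs)`, and p528785's `BlockedRep.norm_integral_sub_ref_le` bounds
`|E_σ f − ∫ obs f dμ| ≤ D(a) := 2e·a·2⁸¹(2e)⁸²` for every `σ`.

* §1 the standard mesh-`b` frame `stdFrame`, the corner plaquette `p₀ = (−e₀; 0,1)` of its centre cell, the frozen-link traces `linkObsC ∕ linkObs`,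
  the phased centre observables `phaseObs u` (`‖u‖ ≤ 1`), the point gauge transformation `flip z` (`g(0) = z`, `g = 1` elsewhere) and the identity
  `phaseObs u ∘ flip z = phaseObs (u c)` for a central `z` with `ρ z = c·𝟙` (`linkObsC_flip`, `phaseObs_flip`).
* §2 kernel identities — gauge covariance `E_{flip σ} F = E_σ (F ∘ flip)` (`ymSpecification_map_gaugeTransformZd_holds`), frozen corner links
  (`integral_ymSpecification`: the three outer links of `p₀` lie OUTSIDE `Λ = cellEdges w 0`) — and the σ-UNIFORM DISORDER BOUND
  `abs_integral_plaquetteObs_le_of_blockedRep`: a blocked representation of the centre cell (`Y = {0}`) in the smallness regime forces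
  `‖1 − c‖ · |E_σ Re tr ρ(U_{p₀})| ≤ 4 D(a) N` for EVERY `σ` (the representation bounds BOTH `E_σ f_u` and `E_{flip σ} f_u = E_σ f_{uc}` against the
  SAME reference value; the FIXED phase `u = conj(1−c)/‖1−c‖` makes `u(1−c) = ‖1−c‖` real).

HONEST FRAMING: toolkit lemmas about ONE typed supplier currency of ONE open stub of a CONDITIONAL reduction; nothing here asserts a Theses
statement, proves a gap or says anything about Clay.  Sorry-free; axioms `propext`, `Classical.choice`, `Quot.sound`.
-/

set_option autoImplicit false

noncomputable section

open MeasureTheory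
open Literature.MathematicalPhysics.QuantumFieldTheory hiding ZdEdge
open Literature.MathematicalPhysics.QuantumLattice
open Literature.Probability.LatticeModels (Site box mem_box glueWith glueWith_apply_not_mem)
open Literature.Barriers.QuantumFields (scalarCenter scalarCenter_mem_center exists_root_of_unity_ne_one)
open Summit.QuantumFields.YangMills.Cruxes.IR.Tempered (cellEdges windowCells regionEdges)

namespace Summit.QuantumFields.YangMills.Cruxes.IR.BlockedActivity

/-! ## §1 The standard frame, the corner plaquette, the flip (pure algebra) -/

/-- The standard mesh-`b` frame `w i j = b·j` (cell `0` is `[0,b)⁴`). -/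
def stdFrame (b : ℕ) : Fin 4 → ℤ → ℤ := fun _ j => (b : ℤ) * j

/-- The standard frame is a mesh-`b` frame. -/
theorem stdFrame_isFrame (b : ℕ) :
    ∀ i : Fin 4, ∀ j : ℤ, stdFrame b i j + ((b : ℕ) : ℤ) ≤ stdFrame b i (j + 1) ∧
      stdFrame b i (j + 1) ≤ stdFrame b i j + 2 * ((b : ℕ) : ℤ) := by
  intro i j
  have hb : (0 : ℤ) ≤ (b : ℤ) := Int.natCast_nonneg b
  simp only [stdFrame, mul_add, mul_one]
  constructor <;> linarith

/-- Edges of the centre cell of the standard frame: base point in `[0,b)⁴`. -/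
theorem mem_cellEdges_stdFrame_zero {b : ℕ} {e : ZdEdge 4} :
    e ∈ cellEdges (stdFrame b) 0 ↔ ∀ k : Fin 4, 0 ≤ e.1 k ∧ e.1 k < (b : ℤ) := by
  simp [cellEdges, stdFrame, Fintype.mem_piFinset]

/-- The cell region of `Y = {0}` is the centre cell. -/
theorem regionEdges_singleton_zero (w : Fin 4 → ℤ → ℤ) : regionEdges w {0} = cellEdges w 0 := by
  simp [regionEdges]

/-- The corner base point `x_c = −e₀`. -/
def xc : Site 4 := -Pi.single 0 1

/-- Coordinates of `x_c`. -/
theorem xc_apply (k : Fin 4) : xc k = if k = 0 then -1 else 0 := by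
  simp only [xc, Pi.neg_apply, Pi.single_apply]
  split_ifs <;> simp

/-- The corner plaquette `p₀ = (x_c; 0, 1)`: edges `(x_c,0)`, `(0,1)`, `(x_c+e₁,0)`, `(x_c,1)`. -/
def p0 : ZdPlaquette 4 := (xc, ⟨((0 : Fin 4), (1 : Fin 4)), by decide⟩)

/-- The three outer links of `p₀` are outside the centre cell (their `0`-th coordinate is `−1`). -/
theorem corner_not_mem (b : ℕ) :
    (xc, (0 : Fin 4)) ∉ cellEdges (stdFrame b) 0 ∧ (xc + Pi.single 1 1, (0 : Fin 4)) ∉ cellEdges (stdFrame b) 0 ∧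
      (xc, (1 : Fin 4)) ∉ cellEdges (stdFrame b) 0 := by
  refine ⟨fun h => ?_, fun h => ?_, fun h => ?_⟩ <;>
  · have h0 := (mem_cellEdges_stdFrame_zero.1 h 0).1
    simp [xc_apply] at h0

/-- The corner plaquette's edges, and the centre cell with its collar, are based in `box 4 b` (`b ≥ 1`). -/
theorem collar_mem_box {b : ℕ} (hb : 1 ≤ b) :
    (∀ e ∈ cellEdges (stdFrame b) 0 ∪ (plaquettesTouching (cellEdges (stdFrame b) 0)).biUnion plaquetteEdges,
        e.1 ∈ box 4 b) ∧ ∀ e ∈ plaquetteEdges p0, e.1 ∈ box 4 b := by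
  refine ⟨fun e he => ?_, fun e he => ?_⟩ <;> rw [mem_box] <;> intro k
  · rcases Finset.mem_union.1 he with he | he
    · have := (mem_cellEdges_stdFrame_zero.1 he) k
      omega
    · obtain ⟨e', he', hn⟩ := exists_near_of_mem_collar he
      have := (mem_cellEdges_stdFrame_zero.1 he') k
      have := hn k
      omega
  · have h := coord_of_mem_plaquetteEdges he k
    have hx : (p0.1 : Site 4) k = if k = 0 then -1 else 0 := xc_apply k
    rw [hx] at h
    split_ifs at h <;> omega

section Algebra

variable {G : Type} [Group G] {N : ℕ} (ρ : G →* Matrix (Fin N) (Fin N) ℂ)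

/-- `tr ρ(k₁ · U(0,1) · k₂⁻¹ · k₃⁻¹)`: the complex corner plaquette trace with its three outer links frozen. -/
def linkObsC (k₁ k₂ k₃ : G) (U : LGConfig 4 G) : ℂ := (ρ (k₁ * U (0, 1) * k₂⁻¹ * k₃⁻¹)).trace

/-- `Re tr ρ(k₁ · U(0,1) · k₂⁻¹ · k₃⁻¹)`: the corner plaquette observable with its three outer links frozen. -/
def linkObs (k₁ k₂ k₃ : G) (U : LGConfig 4 G) : ℝ := (linkObsC ρ k₁ k₂ k₃ U).re

/-- The corner plaquette observable is `linkObs` at the configuration's own outer links. -/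
theorem plaquetteObs_corner (U : LGConfig 4 G) :
    plaquetteObs ρ xc 0 1 U = linkObs ρ (U (xc, 0)) (U (xc + Pi.single 1 1, 0)) (U (xc, 1)) U := by
  have h : xc + Pi.single 0 1 = 0 := by simp [xc]
  simp only [plaquetteObs, plaquetteHolonomyZd, linkObs, linkObsC, h]

/-- `‖linkObsC‖ ≤ N` for unitary `ρ` (`|tr M| ≤ N` for unitary `M`, tree `FiniteTemperature.norm_trace_le_of_mem_unitaryGroup`). -/
theorem norm_linkObsC_le (hρu : ∀ g, ρ g ∈ Matrix.unitaryGroup (Fin N) ℂ) (k₁ k₂ k₃ : G) (U : LGConfig 4 G) :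
    ‖linkObsC ρ k₁ k₂ k₃ U‖ ≤ N :=
  Literature.Barriers.QuantumFields.FiniteTemperature.norm_trace_le_of_mem_unitaryGroup (hρu _)

/-- `|linkObs| ≤ N` for unitary `ρ`. -/
theorem abs_linkObs_le (hρu : ∀ g, ρ g ∈ Matrix.unitaryGroup (Fin N) ℂ) (k₁ k₂ k₃ : G) (U : LGConfig 4 G) :
    |linkObs ρ k₁ k₂ k₃ U| ≤ N :=
  (Complex.abs_re_le_norm _).trans (norm_linkObsC_le ρ hρu k₁ k₂ k₃ U)

/-- The phased centre observable `f_u = (1 + Re(u · linkObsC)/N)/2` (`‖u‖ ≤ 1` gives values in `[0,1]`). -/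
def phaseObs (u : ℂ) (k₁ k₂ k₃ : G) (U : LGConfig 4 G) : ℝ := (1 + (u * linkObsC ρ k₁ k₂ k₃ U).re / N) / 2

/-- `phaseObs ∈ [0,1]` for unitary `ρ`, `N ≥ 1`, `‖u‖ ≤ 1`. -/
theorem phaseObs_mem (hρu : ∀ g, ρ g ∈ Matrix.unitaryGroup (Fin N) ℂ) (hN : 1 ≤ N) {u : ℂ} (hu : ‖u‖ ≤ 1)
    (k₁ k₂ k₃ : G) (U : LGConfig 4 G) : 0 ≤ phaseObs ρ u k₁ k₂ k₃ U ∧ phaseObs ρ u k₁ k₂ k₃ U ≤ 1 := by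
  have hN' : (0 : ℝ) < N := by exact_mod_cast hN
  have hb : |(u * linkObsC ρ k₁ k₂ k₃ U).re| ≤ N := by
    refine (Complex.abs_re_le_norm _).trans ?_
    rw [norm_mul]
    calc ‖u‖ * ‖linkObsC ρ k₁ k₂ k₃ U‖ ≤ 1 * N :=
          mul_le_mul hu (norm_linkObsC_le ρ hρu k₁ k₂ k₃ U) (norm_nonneg _) zero_le_one
      _ = N := one_mul _
  have h := abs_le.1 hb
  have hl : -1 ≤ (u * linkObsC ρ k₁ k₂ k₃ U).re / N := by rw [le_div_iff₀ hN']; linarith [h.1]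
  have hu' : (u * linkObsC ρ k₁ k₂ k₃ U).re / N ≤ 1 := by rw [div_le_iff₀ hN']; linarith [h.2]
  unfold phaseObs
  constructor <;> linarith

/-- The point gauge function: `z` at the origin, `1` elsewhere. -/
def flipGauge (z : G) : Site 4 → G := fun x => if x = 0 then z else 1

/-- The flip: the point gauge transformation by `flipGauge z`. -/
def flip (z : G) : LGConfig 4 G → LGConfig 4 G := gaugeTransformZd (flipGauge z)

/-- The flip multiplies the link `U(0,1)` by `z` on the left. -/
theorem flip_apply_e0 (z : G) (U : LGConfig 4 G) : flip z U (0, 1) = z * U (0, 1) := by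
  simp [flip, flipGauge, gaugeTransformZd]

/-- Under the flip by a central `z` with `ρ z = c·𝟙`: `linkObsC ∘ flip z = c · linkObsC`. -/
theorem linkObsC_flip (z : G) (hz : z ∈ Subgroup.center G) (c : ℂ) (hρz : ρ z = c • (1 : Matrix (Fin N) (Fin N) ℂ))
    (k₁ k₂ k₃ : G) (U : LGConfig 4 G) : linkObsC ρ k₁ k₂ k₃ (flip z U) = c * linkObsC ρ k₁ k₂ k₃ U := by
  have hc : k₁ * (z * U (0, 1)) * k₂⁻¹ * k₃⁻¹ = z * (k₁ * U (0, 1) * k₂⁻¹ * k₃⁻¹) := by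
    rw [← mul_assoc k₁ z, Subgroup.mem_center_iff.1 hz k₁]; simp only [mul_assoc]
  simp only [linkObsC, flip_apply_e0, hc, map_mul, hρz, Matrix.smul_mul, Matrix.one_mul, Matrix.trace_smul, smul_eq_mul]

/-- Under the flip: `f_u ∘ flip z = f_{u c}`. -/
theorem phaseObs_flip (z : G) (hz : z ∈ Subgroup.center G) (c : ℂ) (hρz : ρ z = c • (1 : Matrix (Fin N) (Fin N) ℂ))
    (u : ℂ) (k₁ k₂ k₃ : G) (U : LGConfig 4 G) : phaseObs ρ u k₁ k₂ k₃ (flip z U) = phaseObs ρ (u * c) k₁ k₂ k₃ U := by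
  simp only [phaseObs, linkObsC_flip ρ z hz c hρz, mul_assoc]

/-- A central scalar value `c·𝟙` of a unitary representation has `‖c‖ ≤ 1` (`N ≥ 1`). -/
theorem norm_le_one_of_smul_one_mem_unitary (hN : 1 ≤ N) {c : ℂ}
    (h : c • (1 : Matrix (Fin N) (Fin N) ℂ) ∈ Matrix.unitaryGroup (Fin N) ℂ) : ‖c‖ ≤ 1 := by
  simpa using entry_norm_bound_of_unitary h (⟨0, hN⟩ : Fin N) ⟨0, hN⟩

end Algebra

/-! ## §2 Kernel identities (gauge covariance under the flip, frozen corner links) and the σ-uniform disorder bound -/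

section Kernel

variable {G : Type} [Group G] [TopologicalSpace G] [IsTopologicalGroup G] [CompactSpace G]
  [MeasurableSpace G] [BorelSpace G] [SecondCountableTopology G] {N : ℕ} (ρ : G →* Matrix (Fin N) (Fin N) ℂ)

omit [CompactSpace G] [MeasurableSpace G] [BorelSpace G] [SecondCountableTopology G] in
/-- `linkObsC` is continuous for continuous `ρ`. -/
theorem continuous_linkObsC (hρ : Continuous ρ) (k₁ k₂ k₃ : G) : Continuous (linkObsC ρ k₁ k₂ k₃) := by
  unfold linkObsC
  refine Continuous.matrix_trace (hρ.comp ?_)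
  fun_prop

omit [CompactSpace G] [MeasurableSpace G] [BorelSpace G] [SecondCountableTopology G] in
/-- `linkObs` is continuous for continuous `ρ`. -/
theorem continuous_linkObs (hρ : Continuous ρ) (k₁ k₂ k₃ : G) : Continuous (linkObs ρ k₁ k₂ k₃) :=
  Complex.continuous_re.comp (continuous_linkObsC ρ hρ k₁ k₂ k₃)

omit [CompactSpace G] [MeasurableSpace G] [BorelSpace G] [SecondCountableTopology G] in
/-- `phaseObs` is continuous for continuous `ρ`. -/
theorem continuous_phaseObs (hρ : Continuous ρ) (u : ℂ) (k₁ k₂ k₃ : G) : Continuous (phaseObs ρ u k₁ k₂ k₃) := by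
  unfold phaseObs
  exact (continuous_const.add
    ((Complex.continuous_re.comp (continuous_const.mul (continuous_linkObsC ρ hρ k₁ k₂ k₃))).div_const _)).div_const _

omit [CompactSpace G] in
/-- `phaseObs` is a centre observable of the standard mesh-`b` frame (`b ≥ 1`, `‖u‖ ≤ 1`). -/
theorem isCentreObs_phaseObs (hρ : Continuous ρ) (hρu : ∀ g, ρ g ∈ Matrix.unitaryGroup (Fin N) ℂ) (hN : 1 ≤ N)
    {b : ℕ} (hb : 1 ≤ b) {u : ℂ} (hu : ‖u‖ ≤ 1) (k₁ k₂ k₃ : G) : IsCentreObs (stdFrame b) (phaseObs ρ u k₁ k₂ k₃) := by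
  refine ⟨fun U V h => ?_, (continuous_phaseObs ρ hρ u k₁ k₂ k₃).measurable, phaseObs_mem ρ hρu hN hu k₁ k₂ k₃⟩
  have he : ((0 : Site 4), (1 : Fin 4)) ∈ (↑(cellEdges (stdFrame b) 0) : Set (ZdEdge 4)) := by
    rw [Finset.mem_coe, mem_cellEdges_stdFrame_zero]
    exact fun k => ⟨le_rfl, by change (0 : ℤ) < b; exact_mod_cast hb⟩
  simp only [phaseObs, linkObsC, h _ he]

/-- Gauge covariance of the kernels under the flip: `E_{flip σ} F = E_σ (F ∘ flip)`. -/
theorem integral_ymSpecification_flip (hρ : Continuous ρ) (β : ℝ) (Λ : Finset (ZdEdge 4)) (z : G)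
    {F : LGConfig 4 G → ℝ} (hF : Measurable F) (σ : LGConfig 4 G) :
    ∫ U, F U ∂(ymSpecification ρ β Λ (flip z σ)) = ∫ U, F (flip z U) ∂(ymSpecification ρ β Λ σ) := by
  have h := ymSpecification_map_gaugeTransformZd_holds (d := 4) ρ hρ β Λ σ (flipGauge z)
  change ∫ U, F U ∂(ymSpecification ρ β Λ (gaugeTransformZd (flipGauge z) σ)) =
    ∫ U, F (gaugeTransformZd (flipGauge z) U) ∂(ymSpecification ρ β Λ σ)
  rw [← h, integral_map (measurable_gaugeTransformZd _).aemeasurable hF.aestronglyMeasurable]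

/-- Frozen corner links: if the three outer links of `p₀` are outside `Λ`, the corner plaquette observable integrates under
`γ_Λ(·|σ)` like `linkObs` at `σ`'s outer links. -/
theorem integral_plaquetteObs_corner (hρ : Continuous ρ) (β : ℝ) {Λ : Finset (ZdEdge 4)}
    (h1 : (xc, (0 : Fin 4)) ∉ Λ) (h2 : (xc + Pi.single 1 1, (0 : Fin 4)) ∉ Λ) (h3 : (xc, (1 : Fin 4)) ∉ Λ)
    (σ : LGConfig 4 G) :
    ∫ U, plaquetteObs ρ xc 0 1 U ∂(ymSpecification ρ β Λ σ) =
      ∫ U, linkObs ρ (σ (xc, 0)) (σ (xc + Pi.single 1 1, 0)) (σ (xc, 1)) U ∂(ymSpecification ρ β Λ σ) := by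
  rw [integral_ymSpecification ρ hρ β Λ (measurable_plaquetteObs ρ hρ xc 0 1) σ,
    integral_ymSpecification ρ hρ β Λ ((continuous_linkObs ρ hρ _ _ _).measurable) σ]
  congr 1
  refine integral_congr_ae (ae_of_all _ fun ζ => ?_)
  dsimp only
  rw [plaquetteObs_corner, glueWith_apply_not_mem Λ ζ σ h1, glueWith_apply_not_mem Λ ζ σ h2,
    glueWith_apply_not_mem Λ ζ σ h3]

/-- The activity bound `D(a) = 2 e a 2⁸¹ (2e)⁸²` of `BlockedRep.norm_integral_sub_ref_le`. -/
def actBound (a : ℝ) : ℝ := 2 * Real.exp 1 * a * 2 ^ 81 * (2 * Real.exp 1) ^ 82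

/-- **The σ-uniform representation forces the corner plaquette to be disordered under every exterior datum.**  A blocked
representation of the centre cell of the standard mesh-`b` frame (`Y = {0}`) in the smallness regime and a central `z` with
`ρ z = c·𝟙` give `‖1 − c‖ · |E_σ Re tr ρ(U_{p₀})| ≤ 4 D(a) N` for EVERY `σ`. -/
theorem abs_integral_plaquetteObs_le_of_blockedRep (hρ : Continuous ρ) (hρu : ∀ g, ρ g ∈ Matrix.unitaryGroup (Fin N) ℂ)
    (hN : 1 ≤ N) (z : G) (hz : z ∈ Subgroup.center G) (c : ℂ) (hρz : ρ z = c • (1 : Matrix (Fin N) (Fin N) ℂ))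
    {β a : ℝ} {b : ℕ} (hb : 1 ≤ b) (R : BlockedRep ρ β (stdFrame b) {0} a)
    (h1 : Real.exp 1 * a * ((81 : ℝ) + 1) ^ 2 ≤ 1 / 2) (h2 : Real.exp 1 * a * 2 ^ 81 ≤ 1) (σ : LGConfig 4 G) :
    ‖1 - c‖ * |∫ U, plaquetteObs ρ xc 0 1 U ∂(ymSpecification ρ β (cellEdges (stdFrame b) 0) σ)| ≤
      4 * actBound a * N := by
  letI := R.mΩ
  set Λ := cellEdges (stdFrame b) 0 with hΛ
  set k₁ := σ (xc, 0)
  set k₂ := σ (xc + Pi.single 1 1, 0)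
  set k₃ := σ (xc, 1)
  have hN' : (0 : ℝ) < N := by exact_mod_cast hN
  have hc1 : ‖c‖ ≤ 1 := norm_le_one_of_smul_one_mem_unitary hN (hρz ▸ hρu z)
  -- phase alignment: a FIXED `u`, `‖u‖ ≤ 1`, with `u · (1 − c) = ‖1 − c‖` real
  obtain ⟨u, hu, huc⟩ : ∃ u : ℂ, ‖u‖ ≤ 1 ∧ u * (1 - c) = (‖(1 : ℂ) - c‖ : ℂ) := by
    by_cases hw : (1 : ℂ) - c = 0
    · exact ⟨0, by simp, by simp [hw]⟩
    · have hn : ‖(1 : ℂ) - c‖ ≠ 0 := norm_ne_zero_iff.2 hw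
      have hn' : (‖(1 : ℂ) - c‖ : ℂ) ≠ 0 := by exact_mod_cast hn
      exact ⟨(starRingEnd ℂ) (1 - c) / ‖(1 : ℂ) - c‖,
        by rw [norm_div, Complex.norm_conj, Complex.norm_real, norm_norm, div_self hn],
        by rw [div_mul_eq_mul_div, Complex.conj_mul', sq, mul_div_assoc, div_self hn', mul_one]⟩
  have huc1 : ‖u * c‖ ≤ 1 := by rw [norm_mul]; exact mul_le_one₀ hu (norm_nonneg _) hc1
  have hf : IsCentreObs (stdFrame b) (phaseObs ρ u k₁ k₂ k₃) := isCentreObs_phaseObs ρ hρ hρu hN hb hu k₁ k₂ k₃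
  have hf' : IsCentreObs (stdFrame b) (phaseObs ρ (u * c) k₁ k₂ k₃) := isCentreObs_phaseObs ρ hρ hρu hN hb huc1 k₁ k₂ k₃
  haveI hP : IsProbabilityMeasure (ymSpecification ρ β Λ σ) := isProbabilityMeasure_ymSpecification ρ hρ β Λ σ
  have hLi : Integrable (linkObs ρ k₁ k₂ k₃) (ymSpecification ρ β Λ σ) :=
    integrable_of_bound (continuous_linkObs ρ hρ k₁ k₂ k₃).measurable.aestronglyMeasurable (abs_linkObs_le ρ hρu k₁ k₂ k₃)
  have hiu : Integrable (phaseObs ρ u k₁ k₂ k₃) (ymSpecification ρ β Λ σ) :=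
    integrable_of_bound hf.2.1.aestronglyMeasurable (C := 1)
      (fun U => by rw [abs_le]; have := phaseObs_mem ρ hρu hN hu k₁ k₂ k₃ U; constructor <;> linarith)
  have hiuc : Integrable (phaseObs ρ (u * c) k₁ k₂ k₃) (ymSpecification ρ β Λ σ) :=
    integrable_of_bound hf'.2.1.aestronglyMeasurable (C := 1)
      (fun U => by rw [abs_le]; have := phaseObs_mem ρ hρu hN huc1 k₁ k₂ k₃ U; constructor <;> linarith)
  -- the two representation bounds, at `σ` and at `flip σ`, for the SAME observable `f_u`, against the SAME reference value
  have hA := R.norm_integral_sub_ref_le h1 h2 σ hf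
  have hB := R.norm_integral_sub_ref_le h1 h2 (flip z σ) hf
  rw [regionEdges_singleton_zero] at hA hB
  rw [integral_ymSpecification_flip ρ hρ β Λ z hf.2.1 σ] at hB
  simp only [phaseObs_flip ρ z hz c hρz] at hB
  generalize hI : (∫ ω, R.obs (phaseObs ρ u k₁ k₂ k₃) ω ∂(R.μ)) = I at hA hB
  -- `|E_σ f_u − E_σ f_{uc}| ≤ 2D`
  have hcomb : |(∫ U, phaseObs ρ u k₁ k₂ k₃ U ∂(ymSpecification ρ β Λ σ)) -
      ∫ U, phaseObs ρ (u * c) k₁ k₂ k₃ U ∂(ymSpecification ρ β Λ σ)| ≤ actBound a + actBound a := by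
    have h := (norm_sub_le _ _).trans (add_le_add hA hB)
    rwa [sub_sub_sub_cancel_right, ← Complex.ofReal_sub, Complex.norm_real, Real.norm_eq_abs] at h
  -- `f_u − f_{uc} = ‖1 − c‖ · linkObs / (2N)` pointwise (the phase `u` makes `u(1 − c) = ‖1 − c‖` real)
  have hpt : ∀ U, phaseObs ρ u k₁ k₂ k₃ U - phaseObs ρ (u * c) k₁ k₂ k₃ U =
      ‖1 - c‖ / (2 * N) * linkObs ρ k₁ k₂ k₃ U := by
    intro U
    have key : (u * linkObsC ρ k₁ k₂ k₃ U).re - (u * c * linkObsC ρ k₁ k₂ k₃ U).re =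
        ‖1 - c‖ * (linkObsC ρ k₁ k₂ k₃ U).re := by
      rw [← Complex.sub_re, ← Complex.re_ofReal_mul, ← huc]
      congr 1
      ring
    simp only [phaseObs, linkObs]
    rw [show (u * linkObsC ρ k₁ k₂ k₃ U).re = ‖1 - c‖ * (linkObsC ρ k₁ k₂ k₃ U).re + (u * c * linkObsC ρ k₁ k₂ k₃ U).re
      from by linarith [key]]
    field_simp
    ring
  have hAB : (∫ U, phaseObs ρ u k₁ k₂ k₃ U ∂(ymSpecification ρ β Λ σ)) -
      ∫ U, phaseObs ρ (u * c) k₁ k₂ k₃ U ∂(ymSpecification ρ β Λ σ) =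
      ‖1 - c‖ / (2 * N) * ∫ U, linkObs ρ k₁ k₂ k₃ U ∂(ymSpecification ρ β Λ σ) := by
    rw [← integral_sub hiu hiuc, ← integral_const_mul]
    exact integral_congr_ae (ae_of_all _ hpt)
  rw [hAB, abs_mul, abs_of_nonneg (by positivity : (0 : ℝ) ≤ ‖1 - c‖ / (2 * N))] at hcomb
  have hfin : ‖1 - c‖ * |∫ U, linkObs ρ k₁ k₂ k₃ U ∂(ymSpecification ρ β Λ σ)| ≤ 4 * actBound a * N := by
    rw [div_mul_eq_mul_div, div_le_iff₀ (mul_pos two_pos hN')] at hcomb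
    linarith
  obtain ⟨hc1', hc2', hc3'⟩ := corner_not_mem b
  rw [integral_plaquetteObs_corner ρ hρ β hc1' hc2' hc3' σ]
  exact hfin

end Kernel

end Summit.QuantumFields.YangMills.Cruxes.IR.BlockedActivity

end
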